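import Mathlib
import Summits.Ventures.PercRepro.TriangleCapOneBelowLocus

/-!
# PercRepro — THE HUNG GRAPHS ATTAIN THE SECOND-BEST VALUE: `K_{s,s}` with a vertex hung on an edge has `s² + 2`
edges and `Σ_v d(v)² = 2s³ + 4s + 6` — `150` at `(9, 18)`, `276` at `(11, 27)` — and is not `s`-bipartite (it has a
triangle); hence the loci of parts 197d and 197g at the two exceptional cells are equivalences (p3, gen 44;
part 197h)

`hung_sums`: in `D − z = K_{s,s}` (a spanning subgraph of `K(A, Aᶜ)`, `|A| = s`, `s²` edges on `2s` vertices) every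
vertex has degree `s`, so `Σ_{D−z} d² = 2s · s²`, the two neighbours of `z` contribute `2 · 2s`, and `z` itself
`2 + 4`. The census counts `5,040 = 9 · 35 · 16` at `(9, 18)` and `34,650 = 11 · 126 · 25` at `(11, 27)`.
Axioms: standard.
-/

namespace PercRepro

namespace TriangleCap

namespace C047

open Finset

variable {V : Type*} [Fintype V] [DecidableEq V]

/-- In a complete balanced bipartite `D − z` (`|A| = s`, `2s` vertices, `s²` edges) every vertex has degree `s`. -/
theorem deg_del_of_complete_balanced (D : SimpleGraph V) [DecidableRel D.Adj] (z : V)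
    (A : Finset {v : V // v ≠ z}) (s : ℕ) (hA : A.card = s) (hB : BipSub (del D z) A)
    (hcard : Fintype.card {v : V // v ≠ z} = 2 * s) (hE : (del D z).edgeFinset.card = s * s)
    (w : {v : V // v ≠ z}) : deg (del D z) w = s := by
  have hfull : ∀ {x y : {v : V // v ≠ z}}, x ∈ A → y ∉ A → (del D z).Adj x y := fun hx hy =>
    adj_of_bipSub_full (del D z) A hB s hA (by rw [hcard, hE]; congr 1; omega) hx hy
  unfold deg
  by_cases hw : w ∈ A
  · have : univ.filter (fun u => (del D z).Adj w u) = Aᶜ := by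
      ext u
      rw [mem_filter, mem_compl]
      constructor
      · rintro ⟨-, h⟩
        exact fun hu => ((hB w u h).mp hw) hu
      · intro hu
        exact ⟨mem_univ _, hfull hw hu⟩
    rw [this, card_compl, hA, hcard]
    omega
  · have : univ.filter (fun u => (del D z).Adj w u) = A := by
      ext u
      rw [mem_filter]
      constructor
      · rintro ⟨-, h⟩
        by_contra hu
        exact hw ((hB w u h).mpr hu)
      · intro hu
        exact ⟨mem_univ _, (del D z).adj_symm (hfull hu hw)⟩
    rw [this, hA]

/-- **THE SUMS OF A HUNG GRAPH:** `d(z) = 2`, `D − z = K_{s,s}` ⇒ `m = s² + 2` and `Σ_v d(v)² = 2s³ + 4s + 6`. -/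
theorem hung_sums (D : SimpleGraph V) [DecidableRel D.Adj] (z : V) (A : Finset {v : V // v ≠ z}) (s : ℕ)
    (hz : deg D z = 2) (hA : A.card = s) (hB : BipSub (del D z) A)
    (hcard : Fintype.card {v : V // v ≠ z} = 2 * s) (hE : (del D z).edgeFinset.card = s * s) :
    D.edgeFinset.card = s * s + 2 ∧ ∑ v, deg D v * deg D v = 2 * s * s * s + 4 * s + 6 := by
  have hedges := card_edges_del D z
  have hsq := sum_deg_sq_del D z
  have hdeg := deg_del_of_complete_balanced D z A s hA hB hcard hE
  have hS' : ∑ w : {v : V // v ≠ z}, deg (del D z) w * deg (del D z) w = 2 * s * s * s := by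
    rw [sum_congr rfl (fun w _ => by rw [hdeg w]), sum_const, card_univ, hcard, smul_eq_mul]
    ring
  have hT : ∑ w : {v : V // v ≠ z}, (if D.Adj w.1 z then deg (del D z) w else 0) = 2 * s := by
    rw [sum_congr rfl (fun w _ => by rw [hdeg w]), sum_del_nbhd_const, hz]
  rw [hz, hE] at hedges
  rw [hz, hS', hT] at hsq
  refine ⟨by omega, ?_⟩
  rw [hsq]
  ring

/-- A hung graph contains the triangle `z x y`, so it is not a spanning subgraph of any `K(B, Bᶜ)`. -/
theorem not_bipSub_of_hung (D : SimpleGraph V) [DecidableRel D.Adj] (z : V) (A : Finset {v : V // v ≠ z}) (s : ℕ)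
    (hA : A.card = s) (hB : BipSub (del D z) A) (hcard : Fintype.card {v : V // v ≠ z} = 2 * s)
    (hE : (del D z).edgeFinset.card = s * s) (x y : {v : V // v ≠ z}) (hx : x ∈ A) (hy : y ∉ A)
    (hxz : D.Adj x.1 z) (hyz : D.Adj y.1 z) (B : Finset V) : ¬ BipSub D B := by
  intro hDB
  have hxy : D.Adj x.1 y.1 := (del_adj D z x y).mp
    (adj_of_bipSub_full (del D z) A hB s hA (by rw [hcard, hE]; congr 1; omega) hx hy)
  have h1 := hDB x.1 z hxz
  have h2 := hDB y.1 z hyz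
  have h3 := hDB x.1 y.1 hxy
  tauto

/-- **THE HUNG `K_{4,4}` ATTAINS `150` ON `(9, 18)` AND IS NOT `3`-BIPARTITE.** -/
theorem hungK44_value (D : SimpleGraph V) [DecidableRel D.Adj] (hk : Fintype.card V = 9) (hH : HungK44 D) :
    D.edgeFinset.card = 18 ∧ ∑ v, deg D v * deg D v = 150 ∧ ¬ ∃ A : Finset V, A.card = 3 ∧ BipSub D A := by
  obtain ⟨z, A, hz, hA, hB, hE, x, y, hx, hy, hxz, hyz⟩ := hH
  have hcard : Fintype.card {v : V // v ≠ z} = 2 * 4 := by have := card_del z; omega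
  obtain ⟨h1, h2⟩ := hung_sums D z A 4 hz hA hB hcard hE
  refine ⟨h1, h2, ?_⟩
  rintro ⟨B, -, hDB⟩
  exact not_bipSub_of_hung D z A 4 hA hB hcard hE x y hx hy hxz hyz B hDB

/-- **THE HUNG `K_{5,5}` ATTAINS `276` ON `(11, 27)` AND IS NOT `4`-BIPARTITE.** -/
theorem hungK55_value (D : SimpleGraph V) [DecidableRel D.Adj] (hk : Fintype.card V = 11) (hH : HungK55 D) :
    D.edgeFinset.card = 27 ∧ ∑ v, deg D v * deg D v = 276 ∧ ¬ ∃ A : Finset V, A.card = 4 ∧ BipSub D A := by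
  obtain ⟨z, A, hz, hA, hB, hE, x, y, hx, hy, hxz, hyz⟩ := hH
  have hcard : Fintype.card {v : V // v ≠ z} = 2 * 5 := by have := card_del z; omega
  obtain ⟨h1, h2⟩ := hung_sums D z A 5 hz hA hB hcard hE
  refine ⟨h1, h2, ?_⟩
  rintro ⟨B, -, hDB⟩
  exact not_bipSub_of_hung D z A 5 hA hB hcard hE x y hx hy hxz hyz B hDB

/-- **THE CELL `(9, 18)`, AN EQUIVALENCE:** a `K₄⁻`-free graph on `9` vertices with `18` edges that is not
`3`-bipartite has `Σ_v d(v)² = 150` iff it is `K_{4,5}` minus a `2`-star or the hung `K_{4,4}`. -/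
theorem three_diag_nine_iff (D : SimpleGraph V) [DecidableRel D.Adj] (hK : K4mFree D)
    (hk : Fintype.card V = 9) (hm : D.edgeFinset.card = 18)
    (hnb : ¬ ∃ A : Finset V, A.card = 3 ∧ BipSub D A) :
    ∑ v, deg D v * deg D v = 150 ↔
      (∃ (A : Finset V) (v : V), A.card = 4 ∧ BipSub D A ∧ MissingStar D A v) ∨ HungK44 D := by
  constructor
  · exact three_diag_second_locus_nine D hK hk hm hnb
  · rintro (⟨A, v, hAcard, hA, hv⟩ | hH)
    · have h := closed_form_eq_of_missingStar D A hA hv 4 2 hAcard (by rw [hk, hm]) (by omega)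
      rw [hk, hm] at h
      omega
    · exact (hungK44_value D hk hH).2.1

/-- **THE CELL `(11, 27)`, AN EQUIVALENCE:** a non-extremal `K₄⁻`-free graph on `11` vertices with `27` edges has
`Σ_v d(v)² = 276` iff it is `K_{5,6}` minus a `3`-star or the hung `K_{5,5}`. -/
theorem one_below_eleven_iff (D : SimpleGraph V) [DecidableRel D.Adj] (hK : K4mFree D)
    (hk : Fintype.card V = 11) (hm : D.edgeFinset.card = 27) :
    ∑ v, deg D v * deg D v = 276 ↔
      (∃ (A : Finset V) (v : V), A.card = 5 ∧ BipSub D A ∧ MissingStar D A v) ∨ HungK55 D := by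
  constructor
  · exact one_below_second_locus_eleven D hK hk hm
  · rintro (⟨A, v, hAcard, hA, hv⟩ | hH)
    · have h := closed_form_eq_of_missingStar D A hA hv 5 3 hAcard (by rw [hk, hm]) (by omega)
      rw [hk, hm] at h
      omega
    · exact (hungK55_value D hk hH).2.1

end C047

end TriangleCap

end PercRepro
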